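import Summits.MatrixMultiplication.MatrixMultiplication.Theorems.AbelianSTPPCensusShapeCertVPDefs

/-!
# Abelian STPP census — kernel evaluation of the vP certificate checker `ShapeCertVP` (J: orders 326–337)

Cell mm-stpp, route `AbelianSTPPCensusVP`, crux `ShapeExclusionVP337` (stmt-MatrixMultiplication-19191); support file
(no definitions).  `ShapeCertVP.checkV M = true` by `decide +kernel` (no `native_decide`, standard axioms), ONE theorem
per order so that every kernel evaluation starts with empty caches (measured in the seat folder: ≈ 4–8 s per order below
300, ≤ 35 s at the orders 300–337 — candidate-list construction plus the `feasP` packings of the visited nodes);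
`Elab.async false` keeps the evaluations of this file sequential (one kernel computation in memory at a time; tree
precedent `NeelSignC23EK0Cert4`).  The range lemma `checkV_326_337` at the end collects the file; the ten ranges are
assembled on `128 ≤ M ≤ 337` in `AbelianSTPPCensusVPShapeExclusionVP337.lean`, where `ShapeCertVP.checkV_sound`
(`…ShapeCertVPSearch`) and the bridge `ShapeCertVP.shapeExclusionVP_of_checkV` (`…ShapeCertVPFinal`) turn them into
the crux.
-/

set_option linter.dupNamespace false -- `MatrixMultiplication.MatrixMultiplication` (summit = problem, D-0017)
set_option autoImplicit false
set_option Elab.async false -- sequential kernel evaluations (memory high-water of one order at a time)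

namespace Summit.MatrixMultiplication.MatrixMultiplication.Theorems.ShapeCertVP

set_option maxHeartbeats 0 in
/-- certificate check at order `326` (kernel evaluation) -/
theorem checkV_326 : checkV 326 = true := by
  decide +kernel

set_option maxHeartbeats 0 in
/-- certificate check at order `327` (kernel evaluation) -/
theorem checkV_327 : checkV 327 = true := by
  decide +kernel

set_option maxHeartbeats 0 in
/-- certificate check at order `328` (kernel evaluation) -/
theorem checkV_328 : checkV 328 = true := by
  decide +kernel

set_option maxHeartbeats 0 in
/-- certificate check at order `329` (kernel evaluation) -/
theorem checkV_329 : checkV 329 = true := by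
  decide +kernel

set_option maxHeartbeats 0 in
/-- certificate check at order `330` (kernel evaluation) -/
theorem checkV_330 : checkV 330 = true := by
  decide +kernel

set_option maxHeartbeats 0 in
/-- certificate check at order `331` (kernel evaluation) -/
theorem checkV_331 : checkV 331 = true := by
  decide +kernel

set_option maxHeartbeats 0 in
/-- certificate check at order `332` (kernel evaluation) -/
theorem checkV_332 : checkV 332 = true := by
  decide +kernel

set_option maxHeartbeats 0 in
/-- certificate check at order `333` (kernel evaluation) -/
theorem checkV_333 : checkV 333 = true := by
  decide +kernel

set_option maxHeartbeats 0 in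
/-- certificate check at order `334` (kernel evaluation) -/
theorem checkV_334 : checkV 334 = true := by
  decide +kernel

set_option maxHeartbeats 0 in
/-- certificate check at order `335` (kernel evaluation) -/
theorem checkV_335 : checkV 335 = true := by
  decide +kernel

set_option maxHeartbeats 0 in
/-- certificate check at order `336` (kernel evaluation) -/
theorem checkV_336 : checkV 336 = true := by
  decide +kernel

set_option maxHeartbeats 0 in
/-- certificate check at order `337` (kernel evaluation) -/
theorem checkV_337 : checkV 337 = true := by
  decide +kernel

/-- **The vP certificate holds at every order `326 ≤ M ≤ 337`** (collects the evaluations of this file). -/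
theorem checkV_326_337 (M : ℕ) (h₁ : 326 ≤ M) (h₂ : M ≤ 337) : checkV M = true := by
  interval_cases M
  · exact checkV_326
  · exact checkV_327
  · exact checkV_328
  · exact checkV_329
  · exact checkV_330
  · exact checkV_331
  · exact checkV_332
  · exact checkV_333
  · exact checkV_334
  · exact checkV_335
  · exact checkV_336
  · exact checkV_337

end Summit.MatrixMultiplication.MatrixMultiplication.Theorems.ShapeCertVP
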